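import Summits.QuantumFields.YangMills.Theorems.BalabanLadderIRTwistedSlabClassicalRate
import Summits.QuantumFields.YangMills.Theorems.BalabanLadderIRTwistedSlabPlug
import HarnessLib

/-!
# The e₂-projection in T1 is LOAD-BEARING: the unprojected twisted slab violates uniform exponential vacuum dominance

HELPER toward stub **T1** `TwistedSlabAnchor` (LINE `twisted-slab-continuity`, crux `IRcof` stmt-QuantumFields-26930, census row 43; LEAD prover
ym-ir-line-tsc-p1; `--supports` the crux, `--as helper`).  Fourth and last file of the programme «the e₂-projection is load-bearing» (memo
`Cruxes/IRcof/T1-ANATOMY-tsc-p1.md`): a MUST-USE witness in the sense of the cell's `not_pinnedExitAtFree` ∕ `not_uniformExit24`.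

THE STATEMENT.  The corrected plug (`…Plug.twistedSlabAnchor_of_uniform_expVacuumDominance`) closes T1 from the UNIFORM exponential vacuum
dominance of the e₂-PROJECTED slab partition function `projSlabZ = N⁻¹ Σ_k W{z, z^k}`.  Replace `projSlabZ` by its `k = 0` summand, the
UNPROJECTED magnetically twisted slab `W₀ = W{slabTwist z 1}`: ★ `not_unprojected_expVacuumDominance` — for `SU(N)`, `N ≥ 2`, `z = ω^k·1` with
`k` a unit of `ℤ/N`, and every faithful continuous unitary `ρ`, there are NO `ℓ₀ ≥ 2, β₀, c > 0, C ≥ 0` with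
`λ^t ≤ W₀(ℓ₀, L, t; β) ≤ λ^t·exp(C·L·e^{−ct})` (`t ≥ 2`, some `λ = λ(β, L) > 0`) for all `β ≥ β₀`, `L ≥ 2`.

MECHANISM (all on ONE box `ℓ₀ × ℓ₀ × 2`, so no uniformity in the box is used — the obstruction is β → ∞ at fixed volume):
(1) `exists_common_vacuumBounds` — with ONE top eigenvalue `λ₀(β) = ‖𝕋_m‖` of the magnetically twisted transfer operator:
    `λ₀^t ≤ projSlabZ(t)`, `λ₀^t ≤ W₀(t) ≤ λ₀^{t−2}·W₀(2)` (Perron–Frobenius vacuum is flux-free; genuine trace formula `W₀ = Tr 𝕋_m^t`);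
(2) hence the sandwich pins `λ = λ₀(β)` (`le_one_of_pow_le`), so the hypothesis says `W₀(t) ≤ exp(2C·e^{−ct})·projSlabZ(t)` for ALL `β ≥ β₀`;
(3) but `projSlabZ(t)/W₀(t) = N⁻¹ Σ_{k<N} W{z, z^k}(t)/W₀(t) → 1/N` as `β → ∞` (`…ClassicalRate.tendsto_twistRatio_zero_specialUnitary`: every
    `z^k ≠ 1`, `0 < k < N`, is exponentially suppressed — the `N` e₂-flux sectors become DEGENERATE), so `W₀/projSlabZ ≥ 4/3` for large `β`,
    while (2) with `t` large gives `W₀/projSlabZ ≤ 5/4`.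
READING FOR THE CENSUS: «T1 minus the e₂-projection is false along the vacuum-dominance route» — the twisted slab WITHOUT projection has `N`
asymptotically degenerate vacua at every fixed box (the torelon ∕ e-flux splitting is a tunnelling effect), exactly the line card's dead-line
«plain magnetic twist without projection → N torelon vacua», now a kernel theorem; the projection is what T1's uniformity can rest on.

HONEST FRAMING: a NEGATIVE, one-box theorem (fixed lattice, `β → ∞`); it does not touch T1 itself (0∕1), `IRcof`, `IR`, or the Yang–Mills mass
gap (Clay: NOT proved); R4 = `BalabanLadder.UV` only.  References: 't Hooft NPB 153 (1979) §§4–5; van Baal–Koller, Ann. Phys. 174 (1987) 299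
(electric-flux energies from tunnelling); González-Arroyo hep-th/9807108 §8.
-/

set_option autoImplicit false

noncomputable section

open MeasureTheory Filter Topology Function
open scoped BigOperators ENNReal ComplexConjugate
open Literature.Analysis.OperatorTheory Literature.MathematicalPhysics.QuantumFieldTheory
open Literature.MathematicalPhysics.QuantumLattice

namespace Summit.QuantumFields.YangMills.Cruxes.IRcof.TwistedSlab

/-! ## §1 Two real-variable facts -/

/-- If all powers `a^s`, `s ≥ 2`, of a non-negative real are bounded by one constant, then `a ≤ 1`. [folklore] -/
theorem le_one_of_pow_le {a K : ℝ} (h : ∀ s : ℕ, 2 ≤ s → a ^ s ≤ K) : a ≤ 1 := by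
  by_contra hlt
  push Not at hlt
  have ht := tendsto_pow_atTop_atTop_of_one_lt hlt
  obtain ⟨s, hs⟩ := ((ht.eventually_gt_atTop K).and (eventually_ge_atTop 2)).exists
  exact absurd (h s hs.2) (not_le.2 hs.1)

/-- `exp(2C·e^{−ct}) → 1` as `t → ∞`: for `c > 0` there is `t ≥ 2` with `exp(C·2·e^{−ct}) ≤ 5/4`. [folklore] -/
theorem exists_exp_decay_le {c : ℝ} (C : ℝ) (hc : 0 < c) :
    ∃ t : ℕ, 2 ≤ t ∧ Real.exp (C * (2 : ℕ) * Real.exp (-(c * (t : ℝ)))) ≤ 5 / 4 := by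
  -- `C·2·e^{−ct} → 0`, so it is eventually `≤ log(5/4)`
  have h1 : Tendsto (fun t : ℕ => C * (2 : ℕ) * Real.exp (-(c * (t : ℝ)))) atTop (𝓝 (C * (2 : ℕ) * 0)) := by
    refine tendsto_const_nhds.mul (Real.tendsto_exp_atBot.comp ?_)
    have : Tendsto (fun t : ℕ => c * (t : ℝ)) atTop atTop :=
      (tendsto_natCast_atTop_atTop (R := ℝ)).const_mul_atTop hc
    exact tendsto_neg_atTop_atBot.comp this
  rw [mul_zero] at h1
  have hlog : (0 : ℝ) < Real.log (5 / 4) := Real.log_pos (by norm_num)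
  obtain ⟨t, ht⟩ := ((h1.eventually (gt_mem_nhds hlog)).and (eventually_ge_atTop 2)).exists
  refine ⟨t, ht.2, ?_⟩
  calc Real.exp (C * (2 : ℕ) * Real.exp (-(c * (t : ℝ)))) ≤ Real.exp (Real.log (5 / 4)) := Real.exp_le_exp.2 ht.1.le
    _ = 5 / 4 := Real.exp_log (by norm_num)

/-! ## §2 One box, one top eigenvalue: common vacuum bounds for the projected and the unprojected twisted slab -/

section Common

/-- `slabTwist z 1` has trivial electric part. [folklore] -/
private theorem slabTwist_one_castSucc_three {G : Type*} [Group G] (z : G) (i : Fin 3) :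
    slabTwist z (1 : G) i.castSucc 3 = 1 := by
  unfold slabTwist
  fin_cases i <;> simp

variable {G : Type*} [Group G] [TopologicalSpace G] [IsTopologicalGroup G] [CompactSpace G]
  [MeasurableSpace G] [BorelSpace G] [SecondCountableTopology G] {N : ℕ} {ρ : G →* Matrix (Fin N) (Fin N) ℂ}

/-- **Common vacuum bounds.**  For `β ≥ 0`, continuous unitary `ρ`, central `z` with `z^(m+1) = 1` and a box `ℓ × ℓ × L`, ONE number
`λ₀ > 0` (the norm of the magnetically twisted transfer operator `𝕋_m`) satisfies, for every `M`:
`λ₀^{M+2} ≤ projSlabZ(M+2)` (the vacuum is e₂-flux free), `λ₀^{M+2} ≤ W₀(M+2) ≤ λ₀^M · W₀(2)` (`W₀ = W{slabTwist z 1} = Tr 𝕋_m^{M+2} = Σ λᵢ^{M+2}`,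
`0 ≤ λᵢ ≤ λ₀`). [cite: tHooft1979Flux, §5 (5.1)–(5.4)] -/
theorem exists_common_vacuumBounds (hρ : Continuous ρ) (hρu : ∀ g, ρ g ∈ Matrix.unitaryGroup (Fin N) ℂ)
    {β : ℝ} (hβ : 0 ≤ β) {z : G} (hz : z ∈ Subgroup.center G) {m : ℕ} (hzn : z ^ (m + 1) = 1) (ℓ L : ℕ) :
    ∃ lam₀ : ℝ, 0 < lam₀ ∧ ∀ M : ℕ,
      lam₀ ^ (M + 2) ≤ projSlabZ ρ β z (m + 1) ℓ L (M + 2) ∧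
      lam₀ ^ (M + 2) ≤ wilsonFinTorusTensorTwistedPartition ρ β (slabTwist z 1) ℓ ℓ L (M + 2) ∧
      wilsonFinTorusTensorTwistedPartition ρ β (slabTwist z 1) ℓ ℓ L (M + 2) ≤
        lam₀ ^ M * wilsonFinTorusTensorTwistedPartition ρ β (slabTwist z 1) ℓ ℓ L 2 := by
  haveI : IsFiniteMeasure (haarProbability G) := by
    dsimp [haarProbability]; infer_instance
  -- the magnetic slice tensor of `slabTwist z 1` is that of `slabMagTwist z` (only spatial entries are read)
  set zM : Fin 4 → Fin 4 → G := slabTwist z 1 with hzM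
  set φ : ZMod (m + 1) → Fin 4 → G := slabElecTwist z (m + 1) with hφ
  have hφ0 : φ 0 = 1 := slabElecTwist_zero z (m + 1)
  have hφadd : ∀ k k', φ (k + k') = φ k * φ k' := slabElecTwist_add hzn
  have hφc : ∀ k (i : Fin 3), φ k i.castSucc ∈ Subgroup.center G := fun k i => slabElecTwist_castSucc_mem_center hz _ k i
  obtain ⟨C, A, s, hcnt, b, lam, i₀, hC, hA, hb, hlam, hi₀, hL0⟩ :=
    exists_eigenbasis_finTorusSliceKernelTw hρ hρu hβ (finSliceTwistTensor zM : FinSpatialSite ℓ ℓ L → Fin 3 → Fin 3 → G)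
  haveI : Countable s := hcnt
  have hK := stronglyMeasurable_uncurry_finTorusSliceKernelTw (b₁ := ℓ) (b₂ := ℓ) (b₃ := L) ρ hρ β (finSliceTwistTensor zM)
  have hsymm : ∀ x y : FinSpatialSite ℓ ℓ L × Fin 3 → G,
      finTorusSliceKernelTw ρ β (finSliceTwistTensor zM) x y = finTorusSliceKernelTw ρ β (finSliceTwistTensor zM) y x :=
    finTorusSliceKernelTw_symm ρ hρu β _
  have hKpos : ∀ x y : FinSpatialSite ℓ ℓ L × Fin 3 → G, 0 < finTorusSliceKernelTw ρ β (finSliceTwistTensor zM) x y :=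
    finTorusSliceKernelTw_pos ρ hρ β _
  have hT0 : (finSliceTwist (φ 0) : (FinSpatialSite ℓ ℓ L × Fin 3 → G) → _) = id := by
    rw [hφ0]; exact finSliceTwist_one
  have hTadd : ∀ (k k' : ZMod (m + 1)) (x : FinSpatialSite ℓ ℓ L × Fin 3 → G),
      finSliceTwist (φ (k + k')) x = finSliceTwist (φ k) (finSliceTwist (φ k') x) := fun k k' x => by
    rw [finSliceTwist_finSliceTwist, hφadd]
  have hT : ∀ k : ZMod (m + 1), MeasurePreserving (finSliceTwist (φ k) : (FinSpatialSite ℓ ℓ L × Fin 3 → G) → _)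
      (Measure.pi fun _ => haarProbability G) (Measure.pi fun _ => haarProbability G) :=
    fun k => measurePreserving_finSliceTwist (φ k)
  have hKT : ∀ (k : ZMod (m + 1)) (x y : FinSpatialSite ℓ ℓ L × Fin 3 → G),
      finTorusSliceKernelTw ρ β (finSliceTwistTensor zM) (finSliceTwist (φ k) x) (finSliceTwist (φ k) y) =
        finTorusSliceKernelTw ρ β (finSliceTwistTensor zM) x y :=
    fun k x y => finTorusSliceKernelTw_finSliceTwist ρ (hφc k) β _ x y
  have hlam0 : ∀ i, 0 ≤ lam i := fun i => (hlam i).1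
  have hlam₀pos : 0 < lam i₀ := lt_of_le_of_ne (hlam0 i₀) (Ne.symm hL0)
  -- (a) the projected slab: the magnetic tensor `slabMagTwist z` of `…OneBox` has the same spatial part as `zM = slabTwist z 1`
  have hsame : (finSliceTwistTensor (slabMagTwist z) : FinSpatialSite ℓ ℓ L → Fin 3 → Fin 3 → G) = finSliceTwistTensor zM := by
    funext p i j
    unfold finSliceTwistTensor slabMagTwist
    rw [hzM]
    unfold slabTwist
    fin_cases i <;> fin_cases j <;> simp
  have hzz : ∀ (k : ZMod (m + 1)) (M : ℕ),
      (fun k n => wilsonFinTorusTensorTwistedPartition ρ β (elecMagTwistTensor (φ k) (slabMagTwist z)) ℓ ℓ L n) k (M + 2) =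
      ∫ x, ((fun f : (FinSpatialSite ℓ ℓ L × Fin 3 → G) → ℝ => fun u =>
            ∫ y, finTorusSliceKernelTw ρ β (finSliceTwistTensor zM) u y * f y
              ∂(Measure.pi fun _ : FinSpatialSite ℓ ℓ L × Fin 3 => haarProbability G))^[M + 1]
          (fun y => finTorusSliceKernelTw ρ β (finSliceTwistTensor zM) y x)) (finSliceTwist (φ k) x)
        ∂(Measure.pi fun _ : FinSpatialSite ℓ ℓ L × Fin 3 => haarProbability G) := fun k M => by
    have h := wilsonFinTorusTensorTwistedPartition_elecMag_eq_integral_iterate ρ hρ β (hφc k) (slabMagTwist z) ℓ ℓ L M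
    rw [hsame] at h
    exact h
  have hlowP : ∀ M : ℕ, lam i₀ ^ M * lam i₀ ^ 2 ≤ projSlabZ ρ β z (m + 1) ℓ L (M + 2) := fun M => by
    rw [projSlabZ_eq_re_magneticFluxPartition]
    exact le_re_fluxSector_zero (T := fun k => finSliceTwist (φ k)) hK hC hsymm hKpos hA hb hlam0 hi₀ hL0 hT hT0
      hTadd hKT hzz M
  -- (b) the unprojected slab: genuine trace formula `W₀(M+2) = Σ λᵢ^{M+2}`
  have hZ : ∀ M : ℕ, HasSum (fun i => lam i ^ (M + 2))
      (wilsonFinTorusTensorTwistedPartition ρ β zM ℓ ℓ L (M + 2)) := fun M => by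
    rw [wilsonFinTorusTensorTwistedPartition_eq_integral_prod_finTorusSliceKernelTw_of_eq_one ρ hρ β
      (slabTwist_one_castSucc_three z) ℓ ℓ L (M + 2)]
    simp_rw [finRotate_apply]
    exact hasSum_pow_integral_cyclic hK hC hsymm hA hb hlam0 M
  refine ⟨lam i₀, hlam₀pos, fun M => ⟨?_, ?_, ?_⟩⟩
  · calc lam i₀ ^ (M + 2) = lam i₀ ^ M * lam i₀ ^ 2 := pow_add _ _ _
      _ ≤ _ := hlowP M
  · exact le_hasSum (hZ M) i₀ fun j _ => pow_nonneg (hlam0 j) _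
  · -- `Σ λᵢ^{M+2} ≤ λ₀^M Σ λᵢ²`
    have h2 := (hZ 0).mul_left (lam i₀ ^ M)
    refine hasSum_le (fun i => ?_) (hZ M) h2
    rw [pow_add]
    exact mul_le_mul_of_nonneg_right (pow_le_pow_left₀ (hlam0 i) (hlam i).2 M) (pow_nonneg (hlam0 i) _)

end Common

/-! ## §3 The negative theorem for `SU(N)` -/

section SpecialUnitary

variable {N : ℕ} [NeZero N] [MeasurableSpace (Matrix.specialUnitaryGroup (Fin N) ℂ)]
  [BorelSpace (Matrix.specialUnitaryGroup (Fin N) ℂ)] {d : ℕ}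
  {ρ : Matrix.specialUnitaryGroup (Fin N) ℂ →* Matrix (Fin d) (Fin d) ℂ}

omit [MeasurableSpace (Matrix.specialUnitaryGroup (Fin N) ℂ)] [BorelSpace (Matrix.specialUnitaryGroup (Fin N) ℂ)] in
/-- Powers `(ω^k·1)^j`, `0 < j < N`, of a GENERATING centre element of `SU(N)` are non-trivial (primitivity of `ω^k`). [folklore] -/
theorem suCenter_pow_ne_one {k : ZMod N} (hk : IsUnit k) {j : ℕ} (hj : 0 < j) (hjN : j < N) :
    ((suCenter N k : Matrix.specialUnitaryGroup (Fin N) ℂ)) ^ j ≠ 1 := by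
  have hprim := isPrimitiveRoot_centerPhase N hk
  have hmat : ∀ i : ℕ, ((((suCenter N k : Matrix.specialUnitaryGroup (Fin N) ℂ)) ^ i : Matrix.specialUnitaryGroup (Fin N) ℂ) :
      Matrix (Fin N) (Fin N) ℂ) = centerPhase N k ^ i • (1 : Matrix (Fin N) (Fin N) ℂ) := by
    intro i
    induction i with
    | zero => simp
    | succ i ih =>
        rw [pow_succ, pow_succ]
        change ((((suCenter N k : Matrix.specialUnitaryGroup (Fin N) ℂ)) ^ i : Matrix.specialUnitaryGroup (Fin N) ℂ) :
          Matrix (Fin N) (Fin N) ℂ) * ((suCenter N k : Matrix.specialUnitaryGroup (Fin N) ℂ) : Matrix (Fin N) (Fin N) ℂ) = _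
        rw [ih, coe_suCenter, Matrix.smul_mul, Matrix.one_mul, smul_smul]
  intro h
  have h1 : centerPhase N k ^ j • (1 : Matrix (Fin N) (Fin N) ℂ) = 1 := by
    rw [← hmat j, h]; rfl
  have h00 := congrFun (congrFun h1 0) 0
  simp only [Matrix.smul_apply, Matrix.one_apply_eq, smul_eq_mul, mul_one] at h00
  exact hprim.pow_ne_one_of_pos_of_lt hj.ne' hjN h00

/-- ★★ **THE e₂-PROJECTION IS LOAD-BEARING: the UNPROJECTED twisted slab violates uniform exponential vacuum dominance.**  `SU(N)`, `N ≥ 2`,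
`z = ω^k·1` with `k` a unit of `ℤ/N`, `ρ` faithful continuous unitary.  There are NO `ℓ₀ ≥ 2`, `β₀`, `c > 0`, `C ≥ 0` such that for all
`β ≥ β₀`, `L ≥ 2` some `λ > 0` sandwiches the magnetically twisted, electrically UNPROJECTED slab partition function
`W₀(t) = W{slabTwist z 1}(ℓ₀, ℓ₀, L, t)` as `λ^t ≤ W₀(t) ≤ λ^t·exp(C·L·e^{−ct})` for all `t ≥ 2` — the hypothesis of the T1-plug
`twistedSlabAnchor_of_uniform_expVacuumDominance` with `projSlabZ` replaced by its `k = 0` summand.  Reason: on the fixed box `ℓ₀ × ℓ₀ × 2`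
the `N` e₂-flux sectors degenerate as `β → ∞` (`projSlabZ/W₀ → 1/N`, `…ClassicalRate`), while the sandwich (with `λ` pinned to the top
eigenvalue by `exists_common_vacuumBounds`) would keep `W₀ ≤ e^{2C e^{−ct}}·projSlabZ` for all `β`.  HONEST: a negative, one-box statement; T1
itself is untouched (0∕1). [cite: tHooft1979Flux, §5] -/
theorem not_unprojected_expVacuumDominance (hN : 2 ≤ N) {k : ZMod N} (hk : IsUnit k)
    (hρ : Continuous ρ) (hρu : ∀ g, ρ g ∈ Matrix.unitaryGroup (Fin d) ℂ) (hinj : Function.Injective ρ) :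
    ¬ ∃ (ℓ₀ : ℕ) (β₀ c C : ℝ), 2 ≤ ℓ₀ ∧ 0 < c ∧ 0 ≤ C ∧
        ∀ β : ℝ, β₀ ≤ β → ∀ L : ℕ, 2 ≤ L → ∃ lam : ℝ, 0 < lam ∧ ∀ t : ℕ, 2 ≤ t →
          lam ^ t ≤ wilsonFinTorusTensorTwistedPartition ρ β
              (slabTwist (suCenter N k : Matrix.specialUnitaryGroup (Fin N) ℂ) 1) ℓ₀ ℓ₀ L t ∧
          wilsonFinTorusTensorTwistedPartition ρ β
              (slabTwist (suCenter N k : Matrix.specialUnitaryGroup (Fin N) ℂ) 1) ℓ₀ ℓ₀ L t ≤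
            lam ^ t * Real.exp (C * (L : ℝ) * Real.exp (-(c * (t : ℝ)))) := by
  rintro ⟨ℓ₀, β₀, c, C, hℓ₀, hc, hC0, hyp⟩
  set z : Matrix.specialUnitaryGroup (Fin N) ℂ := (suCenter N k : Matrix.specialUnitaryGroup (Fin N) ℂ) with hzdef
  have hz : z ∈ Subgroup.center (Matrix.specialUnitaryGroup (Fin N) ℂ) := (suCenter N k).2
  obtain ⟨l, rfl⟩ : ∃ l, ℓ₀ = l + 1 := ⟨ℓ₀ - 1, by omega⟩
  obtain ⟨n, hnN⟩ : ∃ n, N = n + 1 := ⟨N - 1, by have := NeZero.ne N; omega⟩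
  have hzn : z ^ (n + 1) = 1 := by
    rw [← hnN, hzdef]
    have h := congrArg (fun g : Subgroup.center (Matrix.specialUnitaryGroup (Fin N) ℂ) =>
      (g : Matrix.specialUnitaryGroup (Fin N) ℂ)) (suCenter_pow_card (N := N) k)
    simpa using h
  -- abbreviations on the box `(l+1) × (l+1) × 2`
  set W : ℝ → ℕ → ℕ → ℝ := fun β j t =>
    wilsonFinTorusTensorTwistedPartition ρ β (slabTwist z (z ^ j)) (l + 1) (l + 1) 2 t with hW
  have hW0 : ∀ β t, wilsonFinTorusTensorTwistedPartition ρ β (slabTwist z 1) (l + 1) (l + 1) 2 t = W β 0 t := fun β t => by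
    simp only [hW, pow_zero]
  have hWpos : ∀ β j t, 0 < W β j t := fun β j t => wilsonFinTorusTensorTwistedPartition_pos ρ hρ β _ _ _ _ _
  -- (1) choose the period `t`
  obtain ⟨t, ht2, hEt⟩ := exists_exp_decay_le C hc
  -- (2) for every `β ≥ max β₀ 0`: `W₀(t) ≤ (5/4) · projSlabZ(t)`
  have hupper : ∀ β : ℝ, max β₀ 0 ≤ β → W β 0 t ≤ 5 / 4 * projSlabZ ρ β z (n + 1) (l + 1) 2 t := by
    intro β hβ
    have hβ0 : 0 ≤ β := le_trans (le_max_right _ _) hβ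
    obtain ⟨lam, hlam, hsand⟩ := hyp β (le_trans (le_max_left _ _) hβ) 2 le_rfl
    obtain ⟨lam₀, hlam₀, hcommon⟩ := exists_common_vacuumBounds hρ hρu hβ0 hz hzn (l + 1) 2
    -- pin `lam = lam₀`
    have hle1 : lam ≤ lam₀ := by
      have hq : ∀ s : ℕ, 2 ≤ s → (lam / lam₀) ^ s ≤ W β 0 2 / lam₀ ^ 2 := by
        intro s hs
        obtain ⟨M, rfl⟩ : ∃ M, s = M + 2 := ⟨s - 2, by omega⟩
        have h1 := (hsand (M + 2) hs).1
        have h3 := (hcommon M).2.2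
        rw [hW0] at h1 h3
        rw [hW0] at h3
        rw [div_pow, div_le_div_iff₀ (pow_pos hlam₀ _) (pow_pos hlam₀ 2)]
        calc lam ^ (M + 2) * lam₀ ^ 2 ≤ (lam₀ ^ M * W β 0 2) * lam₀ ^ 2 :=
              mul_le_mul_of_nonneg_right (h1.trans h3) (pow_nonneg hlam₀.le 2)
          _ = W β 0 2 * lam₀ ^ (M + 2) := by ring
      have := le_one_of_pow_le hq
      rwa [div_le_one hlam₀] at this
    have hle2 : lam₀ ≤ lam := by
      have hq : ∀ s : ℕ, 2 ≤ s → (lam₀ / lam) ^ s ≤ Real.exp (C * ((2 : ℕ) : ℝ)) := by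
        intro s hs
        obtain ⟨M, rfl⟩ : ∃ M, s = M + 2 := ⟨s - 2, by omega⟩
        have h1 := (hsand (M + 2) hs).2
        have h3 := (hcommon M).2.1
        rw [hW0] at h1 h3
        rw [div_pow, div_le_iff₀ (pow_pos hlam _)]
        refine h3.trans (h1.trans ?_)
        rw [mul_comm]
        refine mul_le_mul_of_nonneg_right (Real.exp_le_exp.2 ?_) (pow_nonneg hlam.le _)
        have hx : Real.exp (-(c * ((M + 2 : ℕ) : ℝ))) ≤ 1 := by
          rw [Real.exp_le_one_iff]; have : (0:ℝ) ≤ ((M + 2 : ℕ) : ℝ) := by positivity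
          nlinarith
        have : C * ((2 : ℕ) : ℝ) * Real.exp (-(c * ((M + 2 : ℕ) : ℝ))) ≤ C * ((2 : ℕ) : ℝ) * 1 :=
          mul_le_mul_of_nonneg_left hx (by positivity)
        simpa using this
      have := le_one_of_pow_le hq
      rwa [div_le_one hlam] at this
    have hlamEq : lam = lam₀ := le_antisymm hle1 hle2
    -- the sandwich at period `t` against the projected lower bound
    obtain ⟨M, rfl⟩ : ∃ M, t = M + 2 := ⟨t - 2, by omega⟩
    have h1 := (hsand (M + 2) ht2).2
    rw [hW0, hlamEq] at h1
    have hP := (hcommon M).1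
    calc W β 0 (M + 2) ≤ lam₀ ^ (M + 2) * Real.exp (C * ((2 : ℕ) : ℝ) * Real.exp (-(c * ((M + 2 : ℕ) : ℝ)))) := h1
      _ ≤ lam₀ ^ (M + 2) * (5 / 4) := mul_le_mul_of_nonneg_left (by simpa [mul_comm] using hEt) (pow_nonneg hlam₀.le _)
      _ ≤ projSlabZ ρ β z (n + 1) (l + 1) 2 (M + 2) * (5 / 4) := mul_le_mul_of_nonneg_right hP (by norm_num)
      _ = 5 / 4 * projSlabZ ρ β z (n + 1) (l + 1) 2 (M + 2) := by ring
  -- (3) the flux sectors degenerate: `projSlabZ(t)/W₀(t) → 1/N` as `β → ∞`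
  have hratio : ∀ j : Fin (n + 1), Tendsto (fun β : ℝ => W β (j : ℕ) t / W β 0 t) atTop
      (𝓝 (if (j : ℕ) = 0 then 1 else 0)) := by
    intro j
    by_cases hj : (j : ℕ) = 0
    · rw [if_pos hj, hj]
      exact tendsto_const_nhds.congr fun β => (div_self (hWpos β 0 t).ne').symm
    · rw [if_neg hj]
      have hjN : (j : ℕ) < N := by rw [hnN]; exact j.isLt
      have hE1 : z ^ (j : ℕ) ≠ 1 := suCenter_pow_ne_one hk (Nat.pos_of_ne_zero hj) hjN
      have hEc : z ^ (j : ℕ) ∈ Subgroup.center (Matrix.specialUnitaryGroup (Fin N) ℂ) := Subgroup.pow_mem _ hz _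
      have h := tendsto_twistRatio_zero_specialUnitary (m₀ := l) (m₁ := l) (m₂ := 1) (m₃ := t - 1) (ρ := ρ) hk hEc hE1
        hρ hρu hinj
      have ht1 : t - 1 + 1 = t := by omega
      rw [ht1] at h
      simpa only [hW, pow_zero, Nat.reduceAdd] using h
  have hsum : Tendsto (fun β : ℝ => projSlabZ ρ β z (n + 1) (l + 1) 2 t / W β 0 t) atTop
      (𝓝 (((n + 1 : ℕ) : ℝ)⁻¹ * ∑ j : Fin (n + 1), (if (j : ℕ) = 0 then (1 : ℝ) else 0))) := by
    have hform : ∀ β : ℝ, projSlabZ ρ β z (n + 1) (l + 1) 2 t / W β 0 t =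
        ((n + 1 : ℕ) : ℝ)⁻¹ * ∑ j : Fin (n + 1), W β (j : ℕ) t / W β 0 t := fun β => by
      simp only [hW, projSlabZ, mul_div_assoc, Finset.sum_div]
    simp_rw [hform]
    exact tendsto_const_nhds.mul (tendsto_finsetSum _ fun j _ => hratio j)
  have hval : ((n + 1 : ℕ) : ℝ)⁻¹ * ∑ j : Fin (n + 1), (if (j : ℕ) = 0 then (1 : ℝ) else 0) = ((n + 1 : ℕ) : ℝ)⁻¹ := by
    rw [Finset.sum_boole]
    have : (Finset.univ.filter fun j : Fin (n + 1) => (j : ℕ) = 0) = {0} := by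
      ext j
      simp only [Finset.mem_filter, Finset.mem_univ, true_and, Finset.mem_singleton]
      constructor
      · intro h
        exact Fin.ext (by rw [Fin.val_zero]; exact h)
      · rintro rfl
        exact Fin.val_zero _
    rw [this, Finset.card_singleton, Nat.cast_one, mul_one]
  rw [hval] at hsum
  -- eventually `projSlabZ/W₀ < 3/(4·…)`: precisely `< (5/4)⁻¹ = 4/5`, contradicting (2) since `1/N ≤ 1/2 < 4/5`
  have hNinv : ((n + 1 : ℕ) : ℝ)⁻¹ < 4 / 5 := by
    rw [← hnN]
    have : (2 : ℝ) ≤ N := by exact_mod_cast hN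
    rw [inv_lt_comm₀ (by positivity) (by norm_num)]
    linarith
  obtain ⟨β, hβev, hβge⟩ := ((hsum.eventually (gt_mem_nhds hNinv)).and (eventually_ge_atTop (max β₀ 0))).exists
  have hup := hupper β hβge
  have hPpos : 0 < projSlabZ ρ β z (n + 1) (l + 1) 2 t := projSlabZ_pos ρ hρ β z (Nat.succ_pos n) _ _ _
  have hW0pos : 0 < W β 0 t := hWpos β 0 t
  -- `P/W₀ < 4/5` and `W₀ ≤ (5/4) P` are incompatible
  rw [div_lt_iff₀ (hWpos β 0 t)] at hβev
  nlinarith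

end SpecialUnitary

end Summit.QuantumFields.YangMills.Cruxes.IRcof.TwistedSlab

end
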